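import Summits.QuantumAdvantage.AdviceFreeQNC0.WalkTensorZeroFloor
import Summits.QuantumAdvantage.AdviceFreeQNC0.SPSRingFail
import HarnessLib

/-!
# Route RingFrame, crux α `RingToElim` (stmt-QuantumAdvantage-19119): the DEGREE-0 TENSOR FLOOR read
# on the ring — every polynomial device of degree `D` for the `(n+1)`-cycle errs on at least
# `β^{D+2}·2ⁿ` measurement patterns once `n ≥ m₀(D+2)`, `β = (1 − 2/2^{m₀})/3 ↑ 1/3`

Support theorem for the crux item α in the language of the rung leaf `RingHard 2`
(`Literature…RingHLF.Rel`), transported from the cell's degree-0 tensor floor of the walk game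
(`ringWinU_fail_tensorZero`, `AdviceFreeQNC0/WalkTensorZeroFloor.lean`: block splitting
`blockSplit 0` + the degree-`0` tensor bound `SumCodeZero.pow_mul_le_card_fails`) through the
affine chart of `WalkTransport.lean` (`hasDeg_transport`; fail counts by
`SPSRingFail.card_fail_le_card_not_rel`):

* **`ringRel_fail_tensorZero`** — for `D ≥ 1`, `m₀ ≥ 1`, `0 ≤ β ≤ (1 − 2/2^{m₀})/3`, `n ≥ m₀(D+2)`
  and every tuple `P` of `𝔽₂`-polynomials of degree `≤ D` on `{0,1}^{n+1}`, the relation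
  `Rel x (P x)` FAILS for at least `β^{D+2}·2ⁿ` patterns `x`;
* **`ringRel_fail_tensorZero_eight`** — the instance `m₀ = 8`: `(127/384)^{D+2}·2ⁿ` failures on
  the `(n+1)`-cycle once `n ≥ 8(D+2)` (`127/384 = 0.3307…`: `2^{n − 1.596(D+2)}`, against the fail
  floor's `2^{n−2D−3}` and fail-set hits' `2^{n − 1.757D − O(1)}`).

The cell's statement (prover qn-prover-3 gen 6; ingredients by provers qa-qnc0-prover g7 and
qa-qnc0-prover-2 g0; a special case / instrument for crux α of route RingFrame); not in print.
WHAT THIS IS NOT: not a constant-loss bound (`RingHard 2` / α untouched); density-axis exponent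
`log₂ 3 + ε`, not `< 1`; no separation claim.
-/

-- the sub-problem namespace `Summit.QuantumAdvantage.QuantumAdvantage` repeats the summit name by design (D-0017)
set_option linter.dupNamespace false

noncomputable section

namespace Summit.QuantumAdvantage.QuantumAdvantage.Theorems

open Finset Summit.QuantumAdvantage.AdviceFreeQNC0
open Literature.Computability.QuantumComplexity Literature.Computability.QuantumComplexity.RingHLF
open Literature.Computability.MetaComplexity Literature.Computability.MetaComplexity.Smolensky

/-- **THE DEGREE-0 TENSOR FLOOR ON THE RING.**  For `D ≥ 1`, `m₀ ≥ 1`, `0 ≤ β ≤ (1 − 2/2^{m₀})/3`,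
`n ≥ m₀(D+2)` and every tuple `P` of `𝔽₂`-polynomials of degree `≤ D` on the patterns of the
`(n+1)`-cycle, `Rel x (P x)` fails for at least `β^{D+2}·2ⁿ` patterns `x`. [folklore] -/
theorem ringRel_fail_tensorZero {m₀ : ℕ} (hm₀ : 1 ≤ m₀) {β : ℝ} (hβ0 : 0 ≤ β)
    (hβ : β ≤ (1 - 2 / (2 : ℝ) ^ m₀) / 3) (D : ℕ) (hD : 1 ≤ D) {n : ℕ} (hn : m₀ * (D + 2) ≤ n)
    (P : Fin (n + 1) → CubeFn (ZMod 2) (n + 1)) (hP : ∀ i, P i ∈ lowDeg (ZMod 2) (n + 1) D) :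
    β ^ (D + 2) * (2 : ℝ) ^ n ≤
      ((univ.filter fun x : Fin (n + 1) → Bool => ¬ Rel x (fun i => decide (P i x = 1))).card : ℝ) := by
  classical
  have hn2 : 2 ≤ n := by nlinarith
  set z : (Fin (n + 1) → Bool) → (Fin (n + 1) → Bool) := fun x i => decide (P i x = 1) with hz
  have hdeg : ∀ g, HasDeg ((fun g u => xor (z (xOfU u) g) (tGuess (xOfU u) g)) g) D :=
    fun g => hasDeg_transport hD (P g) (hP g) g
  have h1 := ringWinU_fail_tensorZero hm₀ hβ0 hβ D hn (n + 2) _ hdeg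
  have h2 := SPSRingFail.card_fail_le_card_not_rel hn2 z
  exact le_trans h1 (by exact_mod_cast h2)

/-- **Instance `m₀ = 8`**: on the `(n+1)`-cycle, `n ≥ 8(D+2)`, `D ≥ 1`, every tuple of
`𝔽₂`-polynomials of degree `≤ D` violates `Rel` on at least `(127/384)^{D+2}·2ⁿ` patterns. [folklore] -/
theorem ringRel_fail_tensorZero_eight (D : ℕ) (hD : 1 ≤ D) {n : ℕ} (hn : 8 * (D + 2) ≤ n)
    (P : Fin (n + 1) → CubeFn (ZMod 2) (n + 1)) (hP : ∀ i, P i ∈ lowDeg (ZMod 2) (n + 1) D) :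
    (127 / 384 : ℝ) ^ (D + 2) * (2 : ℝ) ^ n ≤
      ((univ.filter fun x : Fin (n + 1) → Bool => ¬ Rel x (fun i => decide (P i x = 1))).card : ℝ) :=
  ringRel_fail_tensorZero (m₀ := 8) (by norm_num) (by norm_num) (by norm_num) D hD hn P hP

end Summit.QuantumAdvantage.QuantumAdvantage.Theorems

end
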